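import Mathlib
import Literature.NumberTheory.LFunctions.Zhang2022.Section16Lemma162RLocal
import Literature.NumberTheory.Sieve.DivisorBound
import HarnessLib

/-!
# Zhang (2022) §16 Lemma 16.2 at the repaired normaliser (GAP row G-d57-1), part 2: the Euler product
# of `E₂ⱼ(s) = (ζ(s)²ζ(s−β_j)L(s,χ)L(s−β_j,χ)²)⁻¹ Σ_n ϖ₂ⱼ(n)(ν∗χ)(n)n^{−s}` on `σ > 1`

Topic `Literature/NumberTheory/LFunctions/Zhang2022` (Landau–Siegel audit tree; verdict-neutral).
Y. Zhang, *Discrete mean estimates and the Landau–Siegel zero*, arXiv:2211.02515v1 (2022)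
[Zhang2022LandauSiegel] — **an unrefereed manuscript under adjudication; nothing here asserts or denies
its Theorems 1–2.** ZHANG-L WP16 block D, sub-leaf `Typed.Section16B.Lemma162R` (Lemma 16.2 for the
repaired object `frakU2SeriesR` of G-d57-1: "`𝔲₂ⱼ(s)` … is analytic and bounded for `σ > 9/10`", §16 p. 94,
App. A pp. 105–106 "a sketch only"). Theorems only; no definitions, no facts. For a FIXED modulus `D`,
character `χ`, index `j` and the point `s₀ = 1 − β_j`, under two numeric hypotheses that the assembly file
discharges for all large `D` under (A) —

  (H1) `‖F_q(1,1;1−β_j)‖ ≥ 1/2` at every odd prime `q` (`F_q = Section16A.calM2Factor`);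
  (H2) `‖ϖ₂ⱼ(2^e)‖ ≤ B·(e+1)` for all `e`

— this file PROVES, for `σ > 1`, the Euler product
  `E₂ⱼ(s) = ∏'_q Φ_q(s)`,  `Φ_q(s) = N_q(s)·C_q(s)`,
  `N_q(s) = (1−x)²(1−q^{β_j}x)(1−χ(q)x)(1−χ(q)q^{β_j}x)²` (`x = q^{−s}`; the Euler factor of the normaliser⁻¹),
  `C_2(s) = Σ_e ϖ₂ⱼ(2^e)(ν∗χ)(2^e)x^e`, `C_q(s) = Σ_e ϖ₂ⱼ^loc(q^e)(ν∗χ)(q^e)x^e` (`q` odd)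
(`hasProd_frakU2SeriesR`). The mechanism ("`ϖ₂ⱼ` is multiplicative", §16 p. 93, in the kernel form F16B-1 of
the lane: `ϖ₂ⱼ(2^e·m) = ϖ₂ⱼ(2^e)·ϖ₂ⱼ^loc(m)` for odd `m`, tree `Typed.Section16B.varpi2_mul_of_coprime`):
the Dirichlet series of `ϖ₂ⱼ(ν∗χ)` factors as the `2`-part `C_2` times the Euler product of the genuinely
multiplicative `n ↦ 𝟙[n odd]·ϖ₂ⱼ^loc(n)(ν∗χ)(n)n^{−s}` (Mathlib `EulerProduct.eulerProduct_hasProd`; absolute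
convergence from `|ϖ₂ⱼ^loc(q^e)| ≤ 2100(e+1)`, `|(ν∗χ)(n)| ≤ τ(n)²` and the divisor bound), and the Euler
products of `ζ`, `L(·,χ)` (Mathlib) give `∏_q N_q(s) = normaliserR(s)⁻¹`.

## References

* Y. Zhang, arXiv:2211.02515v1 (2022), §16 pp. 93–94 ((16.13), (16.15), Lemma 16.2); App. A pp. 105–106.
  [cite: Zhang2022LandauSiegel, §16 Lemma 16.2 p.94]
* G. H. Hardy, E. M. Wright, *An Introduction to the Theory of Numbers*, Thm 315 (divisor bound). [folklore]
-/

noncomputable section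

open Complex Real Finset Filter Topology

namespace Literature.NumberTheory.LFunctions.Zhang2022.Lemma162R

open Literature.NumberTheory.LFunctions.Zhang2022
open Literature.NumberTheory.LFunctions.Zhang2022.Skeleton
open Literature.NumberTheory.LFunctions.Zhang2022.Typed.Section16A
open Literature.NumberTheory.LFunctions.Zhang2022.Typed.Section16B

/-! ## §0. Folklore -/

section Folklore

/-- `(q^e)^s = (q^s)^e` for naturals `q, e` and complex `s`. [folklore] -/
private theorem natCast_pow_cpow (q e : ℕ) (s : ℂ) : ((q ^ e : ℕ) : ℂ) ^ s = ((q : ℂ) ^ s) ^ e := by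
  induction e with
  | zero => simp
  | succ e ih => rw [pow_succ, Nat.cast_mul, Complex.natCast_mul_natCast_cpow, ih, pow_succ]

/-- `(q^e)^{−s}·` as a power of `x = q^{−s}`: `1/(q^e)^s = (q^{−s})^e`. [folklore] -/
private theorem one_div_natCast_pow_cpow (q e : ℕ) (s : ℂ) :
    1 / ((q ^ e : ℕ) : ℂ) ^ s = ((q : ℂ) ^ (-s)) ^ e := by
  rw [natCast_pow_cpow, Complex.cpow_neg, inv_pow, one_div]

/-- `2^{ω(n)} ≤ τ(n)` (`n ≥ 1`). [folklore] -/
private theorem two_pow_card_primeFactors_le_card_divisors {n : ℕ} (hn : n ≠ 0) :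
    2 ^ n.primeFactors.card ≤ n.divisors.card := by
  rw [Nat.card_divisors hn]
  refine Finset.pow_card_le_prod _ _ _ fun p hp => ?_
  have : 0 < n.factorization p := Nat.Prime.factorization_pos_of_dvd (Nat.prime_of_mem_primeFactors hp)
    hn (Nat.dvd_of_mem_primeFactors hp)
  omega

/-- `1 ≤ τ(n)` for `n ≥ 1`. [folklore] -/
private theorem one_le_card_divisors {n : ℕ} (hn : n ≠ 0) : 1 ≤ n.divisors.card :=
  Finset.card_pos.mpr ⟨1, Nat.one_mem_divisors.mpr hn⟩

/-- `A^{ω(n)} ≤ τ(n)^{log₂ A}` for `A ≥ 1`, `n ≥ 1`. [folklore] -/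
private theorem pow_card_primeFactors_le_rpow_card_divisors {A : ℝ} (hA : 1 ≤ A) {n : ℕ} (hn : n ≠ 0) :
    A ^ n.primeFactors.card ≤ (n.divisors.card : ℝ) ^ Real.logb 2 A := by
  have hA0 : 0 < A := one_pos.trans_le hA
  have ht : 0 ≤ Real.logb 2 A := Real.logb_nonneg one_lt_two hA
  have h2 : (2 : ℝ) ^ (n.primeFactors.card : ℝ) ≤ (n.divisors.card : ℝ) := by
    rw [Real.rpow_natCast]
    exact_mod_cast two_pow_card_primeFactors_le_card_divisors hn
  have hA2 : A = (2 : ℝ) ^ Real.logb 2 A := (Real.rpow_logb two_pos (by norm_num) hA0).symm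
  calc A ^ n.primeFactors.card = ((2 : ℝ) ^ Real.logb 2 A) ^ (n.primeFactors.card : ℝ) := by
        rw [Real.rpow_natCast, ← hA2]
    _ = ((2 : ℝ) ^ (n.primeFactors.card : ℝ)) ^ Real.logb 2 A := by
        rw [← Real.rpow_mul zero_le_two, mul_comm, Real.rpow_mul zero_le_two]
    _ ≤ (n.divisors.card : ℝ) ^ Real.logb 2 A :=
        Real.rpow_le_rpow (by positivity) h2 ht

/-- A function `ℕ → ℂ` bounded by `M·τ(n)^t` has an absolutely convergent `L`-series for `σ > 1` (divisor
bound `τ(n) ≪_ε n^ε`, Hardy–Wright Thm 315, tree `Sieve.exists_card_divisors_le_mul_rpow`). [folklore] -/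
private theorem lseriesSummable_of_le_card_divisors_rpow {g : ℕ → ℂ} {M t : ℝ} (hM : 0 ≤ M) (ht : 0 < t)
    (hg : ∀ n : ℕ, n ≠ 0 → ‖g n‖ ≤ M * (n.divisors.card : ℝ) ^ t) {s : ℂ} (hs : 1 < s.re) :
    LSeriesSummable g s := by
  set δ : ℝ := (s.re - 1) / 2 with hδ
  have hδ0 : 0 < δ := by rw [hδ]; linarith
  obtain ⟨C, hC1, hC⟩ := Literature.NumberTheory.Sieve.exists_card_divisors_le_mul_rpow
    (show 0 < δ / t by positivity)
  have hC0 : 0 ≤ C := zero_le_one.trans hC1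
  have hexp : δ - s.re < -1 := by rw [hδ]; linarith
  have hmaj : Summable fun n : ℕ => M * C ^ t * (n : ℝ) ^ (δ - s.re) :=
    (Real.summable_nat_rpow.mpr hexp).mul_left _
  refine Summable.of_norm_bounded hmaj fun n => ?_
  rcases eq_or_ne n 0 with rfl | hn
  · simp only [LSeries.term_zero, norm_zero, Nat.cast_zero]
    exact mul_nonneg (mul_nonneg hM (Real.rpow_nonneg hC0 t)) (Real.rpow_nonneg le_rfl _)
  have hnR : (0 : ℝ) < n := by exact_mod_cast Nat.pos_of_ne_zero hn
  have hτ0 : (0 : ℝ) ≤ n.divisors.card := Nat.cast_nonneg _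
  rw [LSeries.term_of_ne_zero hn, norm_div, Complex.norm_natCast_cpow_of_pos (Nat.pos_of_ne_zero hn),
    div_le_iff₀ (Real.rpow_pos_of_pos hnR _)]
  have hτ : (n.divisors.card : ℝ) ≤ C * (n : ℝ) ^ (δ / t) := hC n hn
  have hτt : (n.divisors.card : ℝ) ^ t ≤ (C * (n : ℝ) ^ (δ / t)) ^ t := Real.rpow_le_rpow hτ0 hτ ht.le
  calc ‖g n‖ ≤ M * (n.divisors.card : ℝ) ^ t := hg n hn
    _ ≤ M * (C * (n : ℝ) ^ (δ / t)) ^ t := by gcongr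
    _ = M * C ^ t * (n : ℝ) ^ δ := by
        rw [Real.mul_rpow hC0 (Real.rpow_nonneg hnR.le _), ← Real.rpow_mul hnR.le, div_mul_cancel₀ δ ht.ne']
        ring
    _ = M * C ^ t * (n : ℝ) ^ (δ - s.re) * (n : ℝ) ^ s.re := by
        rw [mul_assoc (M * C ^ t), ← Real.rpow_add hnR]; congr 2; ring

end Folklore

/-! ## §1. Majorants for `ϖ₂ⱼ^loc` and `ϖ₂ⱼ` -/

section Majorants

variable (c' : ℝ) {D : ℕ} [NeZero D] (χ : DirichletCharacter ℂ D) (j : ℕ)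

/-- **`|ϖ₂ⱼ^loc(n)| ≤ 2100^{ω(n)}·τ(n)` for ODD `n`**, provided `‖F_q(1,1;1−β_j)‖ ≥ 1/2` at every odd prime
(multiplicativity `Typed.Section16B.varpi2loc_mul_of_coprime` and `norm_varpi2loc_prime_pow_le`; `e+1 = τ(q^e)`).
[cite: Zhang2022LandauSiegel, §16 p.93] -/
theorem norm_varpi2loc_le_of_odd
    (hF : ∀ q : ℕ, q.Prime → q ≠ 2 → 1 / 2 ≤ ‖calM2Factor c' χ q 1 1 (1 - betaJ c' D j)‖) {n : ℕ}
    (hn : n ≠ 0) (hodd : Odd n) :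
    ‖varpi2loc c' χ j n‖ ≤ (2100 : ℝ) ^ n.primeFactors.card * (n.divisors.card : ℝ) := by
  induction n using Nat.recOnPosPrimePosCoprime with
  | prime_pow p k hp hk =>
    have hp2 : p ≠ 2 := by
      rintro rfl
      exact (Nat.not_even_iff_odd.mpr hodd) (Nat.even_pow.mpr ⟨even_two, hk.ne'⟩)
    rw [Nat.primeFactors_prime_pow hk.ne' hp, Finset.card_singleton, pow_one,
      Nat.divisors_prime_pow hp, Finset.card_map, Finset.card_range]
    push_cast
    exact norm_varpi2loc_prime_pow_le c' χ hp k j (hF p hp hp2)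
  | zero => exact absurd rfl hn
  | one =>
    rw [varpi2loc_one, Nat.primeFactors_one, Finset.card_empty, pow_zero, Nat.divisors_one, Finset.card_singleton]
    simp
  | coprime a b ha hb hab iha ihb =>
    have ha0 : a ≠ 0 := by omega
    have hb0 : b ≠ 0 := by omega
    obtain ⟨hoa, hob⟩ := Nat.odd_mul.mp hodd
    rw [varpi2loc_mul_of_coprime c' χ j hab, norm_mul, Nat.Coprime.primeFactors_mul hab,
      Finset.card_union_of_disjoint hab.disjoint_primeFactors, Nat.Coprime.card_divisors_mul hab, Nat.cast_mul]
    calc ‖varpi2loc c' χ j a‖ * ‖varpi2loc c' χ j b‖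
        ≤ ((2100 : ℝ) ^ a.primeFactors.card * (a.divisors.card : ℝ)) *
            ((2100 : ℝ) ^ b.primeFactors.card * (b.divisors.card : ℝ)) :=
          mul_le_mul (iha ha0 hoa) (ihb hb0 hob) (norm_nonneg _) (by positivity)
      _ = (2100 : ℝ) ^ (a.primeFactors.card + b.primeFactors.card) * ((a.divisors.card : ℝ) * b.divisors.card) := by
          ring

/-- **`ϖ₂ⱼ(2^e·m) = ϖ₂ⱼ(2^e)·ϖ₂ⱼ^loc(m)` for odd `m`** (the lane's kernel form F16B-1 of "`ϖ₂ⱼ` is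
multiplicative", `Typed.Section16B.varpi2_mul_of_coprime`, with the nonvanishing of the generic factors at
the odd primes supplied by (H1)). [cite: Zhang2022LandauSiegel, §16 p.93] -/
theorem varpi2_two_pow_mul_odd
    (hF : ∀ q : ℕ, q.Prime → q ≠ 2 → 1 / 2 ≤ ‖calM2Factor c' χ q 1 1 (1 - betaJ c' D j)‖)
    (e : ℕ) {m : ℕ} (hodd : Odd m) :
    varpi2 c' χ j (2 ^ e * m) = varpi2 c' χ j (2 ^ e) * varpi2loc c' χ j m := by
  have hcop : Nat.Coprime (2 ^ e) m := (Nat.coprime_two_left.mpr hodd).pow_left e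
  refine varpi2_mul_of_coprime c' χ j hcop fun q hq => ?_
  have hqP := Nat.prime_of_mem_primeFactors hq
  have hq2 : q ≠ 2 := by
    rintro rfl
    exact (Nat.not_even_iff_odd.mpr hodd) (even_iff_two_dvd.mpr (Nat.dvd_of_mem_primeFactors hq))
  have h := hF q hqP hq2
  intro h0
  rw [h0, norm_zero] at h
  linarith

/-- **`|ϖ₂ⱼ(n)| ≤ B·2100^{ω(n)}·τ(n)`** for `n ≥ 1`, under (H1) and (H2) `|ϖ₂ⱼ(2^e)| ≤ B(e+1)`
(`n = 2^e·m`, `m` odd; `τ(2^e m) = (e+1)τ(m)`). [cite: Zhang2022LandauSiegel, §16 p.93] -/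
theorem norm_varpi2_le
    (hF : ∀ q : ℕ, q.Prime → q ≠ 2 → 1 / 2 ≤ ‖calM2Factor c' χ q 1 1 (1 - betaJ c' D j)‖)
    {B : ℝ} (hB0 : 0 ≤ B) (hB : ∀ e : ℕ, ‖varpi2 c' χ j (2 ^ e)‖ ≤ B * ((e : ℝ) + 1)) {n : ℕ} (hn : n ≠ 0) :
    ‖varpi2 c' χ j n‖ ≤ B * ((2100 : ℝ) ^ n.primeFactors.card * (n.divisors.card : ℝ)) := by
  obtain ⟨e, m, hm, rfl⟩ := Nat.exists_eq_two_pow_mul_odd hn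
  have hm0 : m ≠ 0 := by rintro rfl; simp at hn
  have hcop : Nat.Coprime (2 ^ e) m := (Nat.coprime_two_left.mpr hm).pow_left e
  rw [varpi2_two_pow_mul_odd c' χ j hF e hm, norm_mul, Nat.Coprime.card_divisors_mul hcop,
    Nat.divisors_prime_pow Nat.prime_two, Finset.card_map, Finset.card_range, Nat.cast_mul]
  have hω : m.primeFactors.card ≤ (2 ^ e * m).primeFactors.card :=
    Finset.card_le_card (Nat.primeFactors_mono (dvd_mul_left m _) hn)
  have h1 := hB e
  have h2 := norm_varpi2loc_le_of_odd c' χ j hF hm0 hm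
  have h3 : (2100 : ℝ) ^ m.primeFactors.card ≤ (2100 : ℝ) ^ (2 ^ e * m).primeFactors.card :=
    pow_le_pow_right₀ (by norm_num) hω
  calc ‖varpi2 c' χ j (2 ^ e)‖ * ‖varpi2loc c' χ j m‖
      ≤ (B * ((e : ℝ) + 1)) * ((2100 : ℝ) ^ m.primeFactors.card * (m.divisors.card : ℝ)) :=
        mul_le_mul h1 h2 (norm_nonneg _) (by positivity)
    _ ≤ (B * ((e : ℝ) + 1)) * ((2100 : ℝ) ^ (2 ^ e * m).primeFactors.card * (m.divisors.card : ℝ)) := by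
        gcongr
    _ = B * ((2100 : ℝ) ^ (2 ^ e * m).primeFactors.card * (((e + 1 : ℕ) : ℝ) * (m.divisors.card : ℝ))) := by
        push_cast; ring

/-- **`Σ_n ϖ₂ⱼ(n)(ν∗χ)(n)n^{−s}` converges absolutely for `σ > 1`** under (H1), (H2)
(`|ϖ₂ⱼ(n)(ν∗χ)(n)| ≤ B·2100^{ω(n)}τ(n)³ ≤ B·τ(n)^{3+log₂ 2100}` and the divisor bound).
[cite: Zhang2022LandauSiegel, §16 Lemma 16.2 p.94] -/
theorem lseriesSummable_varpi2_nuConvChi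
    (hF : ∀ q : ℕ, q.Prime → q ≠ 2 → 1 / 2 ≤ ‖calM2Factor c' χ q 1 1 (1 - betaJ c' D j)‖)
    {B : ℝ} (hB0 : 0 ≤ B) (hB : ∀ e : ℕ, ‖varpi2 c' χ j (2 ^ e)‖ ≤ B * ((e : ℝ) + 1)) {s : ℂ} (hs : 1 < s.re) :
    LSeriesSummable (fun n => varpi2 c' χ j n * nuConvChi χ n) s := by
  have hlogb : 0 ≤ Real.logb 2 (2100 : ℝ) := Real.logb_nonneg one_lt_two (by norm_num)
  refine lseriesSummable_of_le_card_divisors_rpow hB0 (t := 3 + Real.logb 2 2100) (by linarith)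
    (fun n hn => ?_) hs
  have hτ1 : (1 : ℝ) ≤ n.divisors.card := by exact_mod_cast one_le_card_divisors hn
  have h1 := norm_varpi2_le c' χ j hF hB0 hB hn
  have h2 := norm_nuConvChi_le χ hn
  have h3 := pow_card_primeFactors_le_rpow_card_divisors (A := (2100 : ℝ)) (by norm_num) hn
  rw [norm_mul]
  calc ‖varpi2 c' χ j n‖ * ‖nuConvChi χ n‖
      ≤ (B * ((2100 : ℝ) ^ n.primeFactors.card * (n.divisors.card : ℝ))) * (n.divisors.card : ℝ) ^ 2 :=
        mul_le_mul h1 h2 (norm_nonneg _) (by positivity)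
    _ ≤ (B * ((n.divisors.card : ℝ) ^ Real.logb 2 2100 * (n.divisors.card : ℝ))) * (n.divisors.card : ℝ) ^ 2 := by
        gcongr
    _ = B * (n.divisors.card : ℝ) ^ (3 + Real.logb 2 2100) := by
        rw [show (3 : ℝ) + Real.logb 2 2100 = Real.logb 2 2100 + ((3 : ℕ) : ℝ) by push_cast; ring,
          Real.rpow_add_natCast (by positivity)]
        ring

/-- **`Σ_n 𝟙[n odd]ϖ₂ⱼ^loc(n)(ν∗χ)(n)n^{−s}` converges absolutely for `σ > 1`** under (H1).
[cite: Zhang2022LandauSiegel, §16 Lemma 16.2 p.94] -/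
theorem lseriesSummable_odd_varpi2loc_nuConvChi
    (hF : ∀ q : ℕ, q.Prime → q ≠ 2 → 1 / 2 ≤ ‖calM2Factor c' χ q 1 1 (1 - betaJ c' D j)‖) {s : ℂ}
    (hs : 1 < s.re) :
    LSeriesSummable (fun n => if Odd n then varpi2loc c' χ j n * nuConvChi χ n else 0) s := by
  have hlogb : 0 ≤ Real.logb 2 (2100 : ℝ) := Real.logb_nonneg one_lt_two (by norm_num)
  refine lseriesSummable_of_le_card_divisors_rpow zero_le_one (t := 3 + Real.logb 2 2100) (by linarith)
    (fun n hn => ?_) hs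
  have hτ1 : (1 : ℝ) ≤ n.divisors.card := by exact_mod_cast one_le_card_divisors hn
  split_ifs with hodd
  · have h1 := norm_varpi2loc_le_of_odd c' χ j hF hn hodd
    have h2 := norm_nuConvChi_le χ hn
    have h3 := pow_card_primeFactors_le_rpow_card_divisors (A := (2100 : ℝ)) (by norm_num) hn
    rw [norm_mul, one_mul]
    calc ‖varpi2loc c' χ j n‖ * ‖nuConvChi χ n‖
        ≤ ((2100 : ℝ) ^ n.primeFactors.card * (n.divisors.card : ℝ)) * (n.divisors.card : ℝ) ^ 2 :=
          mul_le_mul h1 h2 (norm_nonneg _) (by positivity)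
      _ ≤ ((n.divisors.card : ℝ) ^ Real.logb 2 2100 * (n.divisors.card : ℝ)) * (n.divisors.card : ℝ) ^ 2 := by
          gcongr
      _ = (n.divisors.card : ℝ) ^ (3 + Real.logb 2 2100) := by
          rw [show (3 : ℝ) + Real.logb 2 2100 = Real.logb 2 2100 + ((3 : ℕ) : ℝ) by push_cast; ring,
            Real.rpow_add_natCast (by positivity)]
          ring
  · rw [norm_zero, one_mul]; positivity

end Majorants

/-! ## §2. The Euler product of the odd part `n ↦ 𝟙[n odd]ϖ₂ⱼ^loc(n)(ν∗χ)(n)n^{−s}` -/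

section OddPart

variable (c' : ℝ) {D : ℕ} [NeZero D] (χ : DirichletCharacter ℂ D) (j : ℕ)

omit [NeZero D] in
/-- The summand at a prime power: for an odd prime `q`,
`term(q^e) = ϖ₂ⱼ^loc(q^e)(ν∗χ)(q^e)·(q^{−s})^e`; at `q = 2` it is `𝟙[e=0]`.
[cite: Zhang2022LandauSiegel, §16 Lemma 16.2 p.94] -/
theorem term_odd_prime_pow {q : ℕ} (hq : q.Prime) (e : ℕ) (s : ℂ) :
    LSeries.term (fun n => if Odd n then varpi2loc c' χ j n * nuConvChi χ n else 0) s (q ^ e) =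
      if q = 2 then (if e = 0 then 1 else 0)
      else varpi2loc c' χ j (q ^ e) * nuConvChi χ (q ^ e) * ((q : ℂ) ^ (-s)) ^ e := by
  have hqe : q ^ e ≠ 0 := pow_ne_zero _ hq.ne_zero
  rw [LSeries.term_of_ne_zero hqe]
  by_cases h2 : q = 2
  · subst h2
    rw [if_pos rfl]
    by_cases he : e = 0
    · subst he
      rw [if_pos rfl, if_pos (by norm_num : Odd (2 ^ 0)), pow_zero, varpi2loc_one, nuConvChi_one]
      simp
    · rw [if_neg he, if_neg (fun hodd => (Nat.not_even_iff_odd.mpr hodd) (Nat.even_pow.mpr ⟨even_two, he⟩)),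
        zero_div]
  · rw [if_neg h2, if_pos ((hq.odd_of_ne_two h2).pow), div_eq_mul_one_div, one_div_natCast_pow_cpow]

/-- **Euler product of the odd part** (Mathlib `EulerProduct.eulerProduct_hasProd` for the multiplicative,
absolutely summable `n ↦ 𝟙[n odd]ϖ₂ⱼ^loc(n)(ν∗χ)(n)n^{−s}`, `σ > 1`, under (H1)): the factor at `2` is `1`,
at an odd prime `q` it is `C_q(s) = Σ_e ϖ₂ⱼ^loc(q^e)(ν∗χ)(q^e)q^{−es}`.
[cite: Zhang2022LandauSiegel, §16 Lemma 16.2 p.94, App. A p.105] -/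
theorem hasProd_oddPart
    (hF : ∀ q : ℕ, q.Prime → q ≠ 2 → 1 / 2 ≤ ‖calM2Factor c' χ q 1 1 (1 - betaJ c' D j)‖) {s : ℂ}
    (hs : 1 < s.re) :
    HasProd (fun q : Nat.Primes => if (q : ℕ) = 2 then (1 : ℂ) else
        ∑' e : ℕ, varpi2loc c' χ j ((q : ℕ) ^ e) * nuConvChi χ ((q : ℕ) ^ e) * (((q : ℕ) : ℂ) ^ (-s)) ^ e)
      (∑' n : ℕ, LSeries.term (fun n => if Odd n then varpi2loc c' χ j n * nuConvChi χ n else 0) s n) := by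
  set f : ℕ → ℂ := LSeries.term (fun n => if Odd n then varpi2loc c' χ j n * nuConvChi χ n else 0) s
    with hf
  have hf1 : f 1 = 1 := by
    rw [hf, LSeries.term_of_ne_zero one_ne_zero]; simp [varpi2loc_one, nuConvChi_one]
  have hf0 : f 0 = 0 := by rw [hf, LSeries.term_zero]
  have hmul : ∀ {m n : ℕ}, Nat.Coprime m n → f (m * n) = f m * f n := by
    intro m n hmn
    rcases eq_or_ne m 0 with rfl | hm
    · rw [zero_mul, hf0, zero_mul]
    rcases eq_or_ne n 0 with rfl | hn
    · rw [mul_zero, hf0, mul_zero]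
    rw [hf, LSeries.term_of_ne_zero (mul_ne_zero hm hn), LSeries.term_of_ne_zero hm,
      LSeries.term_of_ne_zero hn]
    by_cases hodd : Odd (m * n)
    · obtain ⟨hom, hon⟩ := Nat.odd_mul.mp hodd
      rw [if_pos hodd, if_pos hom, if_pos hon, varpi2loc_mul_of_coprime c' χ j hmn,
        nuConvChi_mul_of_coprime χ hmn, Nat.cast_mul, Complex.natCast_mul_natCast_cpow]
      have h1 : (m : ℂ) ^ s ≠ 0 := (cpow_ne_zero_iff_of_exponent_ne_zero
        (fun h0 => by rw [h0, Complex.zero_re] at hs; linarith)).mpr (by exact_mod_cast hm)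
      have h2 : (n : ℂ) ^ s ≠ 0 := (cpow_ne_zero_iff_of_exponent_ne_zero
        (fun h0 => by rw [h0, Complex.zero_re] at hs; linarith)).mpr (by exact_mod_cast hn)
      field_simp
    · rw [if_neg hodd]
      rw [Nat.odd_mul, not_and_or] at hodd
      rcases hodd with h | h
      · rw [if_neg h]; simp
      · rw [if_neg h]; simp
  have hsum : Summable fun n => ‖f n‖ := (lseriesSummable_odd_varpi2loc_nuConvChi c' χ j hF hs).norm
  have hE := EulerProduct.eulerProduct_hasProd hf1 (fun {m n} h => hmul h) hsum hf0
  refine hE.congr_fun fun q => ?_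
  have hq : (q : ℕ).Prime := q.prop
  have hloc : ∀ e : ℕ, f ((q : ℕ) ^ e) = if (q : ℕ) = 2 then (if e = 0 then 1 else 0)
      else varpi2loc c' χ j ((q : ℕ) ^ e) * nuConvChi χ ((q : ℕ) ^ e) * (((q : ℕ) : ℂ) ^ (-s)) ^ e :=
    fun e => term_odd_prime_pow c' χ j hq e s
  split_ifs with h2
  · rw [show (fun e : ℕ => f ((q : ℕ) ^ e)) = fun e : ℕ => if e = 0 then (1 : ℂ) else 0 by
      funext e; rw [hloc e, if_pos h2]]
    rw [tsum_ite_eq]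
  · exact tsum_congr fun e => by rw [hloc e, if_neg h2]

end OddPart

/-! ## §3. The `2`-adic splitting `Σ_n ϖ₂ⱼ(ν∗χ)n^{−s} = C_2(s) · Σ_{n odd} ϖ₂ⱼ^loc(ν∗χ)n^{−s}` -/

section TwoAdic

variable (c' : ℝ) {D : ℕ} [NeZero D] (χ : DirichletCharacter ℂ D) (j : ℕ)

/-- `2^e·m = 2^{e'}·m'` with `m, m'` odd forces `e = e'` and `m = m'`. [folklore] -/
private theorem two_pow_mul_odd_inj {e e' m m' : ℕ} (hm : Odd m) (hm' : Odd m') (h : 2 ^ e * m = 2 ^ e' * m') :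
    e = e' ∧ m = m' := by
  have hm0 : m ≠ 0 := by rintro rfl; exact (Nat.not_even_iff_odd.mpr hm) Even.zero
  have hm0' : m' ≠ 0 := by rintro rfl; exact (Nat.not_even_iff_odd.mpr hm') Even.zero
  have hv : ∀ {k n : ℕ}, Odd n → padicValNat 2 (2 ^ k * n) = k := by
    intro k n hn
    have hn0 : n ≠ 0 := by rintro rfl; exact (Nat.not_even_iff_odd.mpr hn) Even.zero
    haveI : Fact (Nat.Prime 2) := ⟨Nat.prime_two⟩
    rw [padicValNat.mul (pow_ne_zero _ two_ne_zero) hn0, padicValNat.prime_pow,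
      padicValNat.eq_zero_of_not_dvd (fun h2 => (Nat.not_even_iff_odd.mpr hn) (even_iff_two_dvd.mpr h2)),
      add_zero]
  have he : e = e' := by
    have h1 := hv (k := e) hm
    rw [h, hv hm'] at h1
    exact h1.symm
  subst he
  exact ⟨rfl, Nat.eq_of_mul_eq_mul_left (pow_pos two_pos e) h⟩

/-- **The `2`-adic splitting of the Dirichlet series of `ϖ₂ⱼ(ν∗χ)`** (`σ > 1`, under (H1), (H2)):
`Σ_n ϖ₂ⱼ(n)(ν∗χ)(n)n^{−s} = (Σ_e ϖ₂ⱼ(2^e)(ν∗χ)(2^e)2^{−es}) · Σ_n 𝟙[n odd]ϖ₂ⱼ^loc(n)(ν∗χ)(n)n^{−s}`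
(every `n ≥ 1` is uniquely `2^e·m` with `m` odd, and `ϖ₂ⱼ(2^e m)(ν∗χ)(2^e m) = ϖ₂ⱼ(2^e)(ν∗χ)(2^e)·ϖ₂ⱼ^loc(m)(ν∗χ)(m)`;
absolute convergence justifies the rearrangement). [cite: Zhang2022LandauSiegel, §16 p.93, Lemma 16.2 p.94] -/
theorem tsum_varpi2_nuConvChi_eq_twoPart_mul_oddPart
    (hF : ∀ q : ℕ, q.Prime → q ≠ 2 → 1 / 2 ≤ ‖calM2Factor c' χ q 1 1 (1 - betaJ c' D j)‖)
    {B : ℝ} (hB0 : 0 ≤ B) (hB : ∀ e : ℕ, ‖varpi2 c' χ j (2 ^ e)‖ ≤ B * ((e : ℝ) + 1)) {s : ℂ} (hs : 1 < s.re) :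
    ∑' n : ℕ, LSeries.term (fun n => varpi2 c' χ j n * nuConvChi χ n) s n =
      (∑' e : ℕ, varpi2 c' χ j (2 ^ e) * nuConvChi χ (2 ^ e) * ((2 : ℂ) ^ (-s)) ^ e) *
        ∑' n : ℕ, LSeries.term (fun n => if Odd n then varpi2loc c' χ j n * nuConvChi χ n else 0) s n := by
  set G : ℕ → ℂ := LSeries.term (fun n => varpi2 c' χ j n * nuConvChi χ n) s with hG
  set f : ℕ → ℂ := LSeries.term (fun n => if Odd n then varpi2loc c' χ j n * nuConvChi χ n else 0) s
    with hf
  set T : ℕ → ℂ := fun e => varpi2 c' χ j (2 ^ e) * nuConvChi χ (2 ^ e) * ((2 : ℂ) ^ (-s)) ^ e with hT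
  have hGsum : Summable fun n => ‖G n‖ := (lseriesSummable_varpi2_nuConvChi c' χ j hF hB0 hB hs).norm
  have hfsum : Summable fun n => ‖f n‖ := (lseriesSummable_odd_varpi2loc_nuConvChi c' χ j hF hs).norm
  -- `T e = G(2^e)`
  have hTG : ∀ e : ℕ, T e = G (2 ^ e) := by
    intro e
    rw [hG, hT, LSeries.term_of_ne_zero (pow_ne_zero _ two_ne_zero), div_eq_mul_one_div,
      one_div_natCast_pow_cpow, Nat.cast_ofNat]
  have hTsum : Summable fun e => ‖T e‖ := by
    have h := hGsum.comp_injective (Nat.pow_right_injective (le_refl 2))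
    exact h.congr fun e => by simp only [Function.comp, hTG]
  -- the key identity `G(2^e m) = T e · f m` for odd `m`
  have hkey : ∀ (e : ℕ) {m : ℕ}, Odd m → G (2 ^ e * m) = T e * f m := by
    intro e m hm
    have hm0 : m ≠ 0 := by rintro rfl; exact (Nat.not_even_iff_odd.mpr hm) Even.zero
    have hx : ((2 : ℂ) ^ (-s)) ^ e = 1 / ((2 ^ e : ℕ) : ℂ) ^ s := by
      rw [one_div_natCast_pow_cpow, Nat.cast_ofNat]
    rw [hG, hf, hT, LSeries.term_of_ne_zero (mul_ne_zero (pow_ne_zero _ two_ne_zero) hm0),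
      LSeries.term_of_ne_zero hm0, if_pos hm, varpi2_two_pow_mul_odd c' χ j hF e hm,
      nuConvChi_mul_of_coprime χ ((Nat.coprime_two_left.mpr hm).pow_left e), Nat.cast_mul,
      Complex.natCast_mul_natCast_cpow]
    simp only [hx]
    have h1 : ((2 ^ e : ℕ) : ℂ) ^ s ≠ 0 := (cpow_ne_zero_iff_of_exponent_ne_zero
      (fun h0 => by rw [h0, Complex.zero_re] at hs; linarith)).mpr (by exact_mod_cast pow_ne_zero e two_ne_zero)
    have h2 : (m : ℂ) ^ s ≠ 0 := (cpow_ne_zero_iff_of_exponent_ne_zero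
      (fun h0 => by rw [h0, Complex.zero_re] at hs; linarith)).mpr (by exact_mod_cast hm0)
    field_simp
  -- `f m ≠ 0 ⇒ m odd`
  have hfodd : ∀ {m : ℕ}, f m ≠ 0 → Odd m := by
    intro m hm
    by_contra hodd
    apply hm
    rcases eq_or_ne m 0 with rfl | hm0
    · rw [hf, LSeries.term_zero]
    · rw [hf, LSeries.term_of_ne_zero hm0, if_neg hodd, zero_div]
  rw [tsum_mul_tsum_of_summable_norm hTsum hfsum]
  apply tsum_eq_tsum_of_ne_zero_bij (fun x : Function.support (fun x : ℕ × ℕ => T x.1 * f x.2) =>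
    2 ^ x.1.1 * x.1.2)
  · rintro ⟨⟨e, m⟩, hx⟩ ⟨⟨e', m'⟩, hx'⟩ h
    simp only at h
    have hm : Odd m := hfodd (right_ne_zero_of_mul hx)
    have hm' : Odd m' := hfodd (right_ne_zero_of_mul hx')
    obtain ⟨h1, h2⟩ := two_pow_mul_odd_inj hm hm' h
    subst h1; subst h2; rfl
  · intro n hn
    have hn0 : n ≠ 0 := by
      rintro rfl
      exact hn (by rw [hG, LSeries.term_zero])
    obtain ⟨e, m, hm, rfl⟩ := Nat.exists_eq_two_pow_mul_odd hn0
    refine ⟨⟨(e, m), ?_⟩, rfl⟩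
    rw [Function.mem_support, ← hkey e hm]
    exact hn
  · rintro ⟨⟨e, m⟩, hx⟩
    exact hkey e (hfodd (right_ne_zero_of_mul hx))

end TwoAdic

/-! ## §4. The Euler product of the normaliser `(ζ(s)²ζ(s−β_j)L(s,χ)L(s−β_j,χ)²)⁻¹` -/

section Normaliser

variable (c' : ℝ) {D : ℕ} [NeZero D] (χ : DirichletCharacter ℂ D) (j : ℕ)

/-- An Euler product with nonvanishing value may be inverted factorwise (in `ℂ`). [folklore] -/
private theorem hasProd_inv_of_ne_zero {ι : Type*} {f : ι → ℂ} {a : ℂ} (hf : HasProd f a)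
    (ha : a ≠ 0) : HasProd (fun i => (f i)⁻¹) a⁻¹ := by
  classical
  have hT : Tendsto (fun A : Finset ι => ∏ i ∈ A, f i) atTop (𝓝 a) := hf
  have hT' := hT.inv₀ ha
  have hfun : (fun A : Finset ι => ∏ i ∈ A, (f i)⁻¹) = fun A => (∏ i ∈ A, f i)⁻¹ := by
    funext A; rw [Finset.prod_inv_distrib]
  show Tendsto (fun A : Finset ι => ∏ i ∈ A, (f i)⁻¹) atTop (𝓝 a⁻¹)
  rw [hfun]; exact hT'

omit [NeZero D] in
/-- `q^{−(s−β_j)} = q^{β_j}·q^{−s}`. [cite: Zhang2022LandauSiegel, §16 p.94] -/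
theorem cpow_neg_sub_betaJ {q : ℕ} (hq : q ≠ 0) (s : ℂ) :
    (q : ℂ) ^ (-(s - betaJ c' D j)) = (q : ℂ) ^ betaJ c' D j * (q : ℂ) ^ (-s) := by
  rw [show -(s - betaJ c' D j) = betaJ c' D j + -s by ring, Complex.cpow_add _ _ (by exact_mod_cast hq)]

omit [NeZero D] in
/-- `Re(s − β_j) = Re s`. [cite: Zhang2022LandauSiegel, §2 (2.13)] -/
theorem sub_betaJ_re (s : ℂ) : (s - betaJ c' D j).re = s.re := by
  rw [Complex.sub_re, betaJ_re_eq_zero, sub_zero]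

/-- **The Euler product of the inverse normaliser**: for `σ > 1`,
`∏_q (1−q^{−s})²(1−q^{β_j}q^{−s})(1−χ(q)q^{−s})(1−χ(q)q^{β_j}q^{−s})² = (ζ(s)²ζ(s−β_j)L(s,χ)L(s−β_j,χ)²)⁻¹`
(`normaliserR` of G-d57-1; Euler products of `ζ` and `L(·,χ)`, nonvanishing on `σ > 1`, at `s` and `s−β_j`).
[cite: Zhang2022LandauSiegel, §16 Lemma 16.2 p.94] -/
theorem hasProd_normaliserR_inv {s : ℂ} (hs : 1 < s.re) :
    HasProd (fun q : Nat.Primes =>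
        (1 - ((q : ℕ) : ℂ) ^ (-s)) ^ 2 * (1 - ((q : ℕ) : ℂ) ^ betaJ c' D j * ((q : ℕ) : ℂ) ^ (-s)) *
          (1 - χ ((q : ℕ) : ZMod D) * ((q : ℕ) : ℂ) ^ (-s)) *
            (1 - χ ((q : ℕ) : ZMod D) * (((q : ℕ) : ℂ) ^ betaJ c' D j * ((q : ℕ) : ℂ) ^ (-s))) ^ 2)
      (normaliserR c' χ j s)⁻¹ := by
  set s' : ℂ := s - betaJ c' D j with hs'
  have hs1 : 1 < s'.re := by rw [hs', sub_betaJ_re]; exact hs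
  have hζ : HasProd (fun p : Nat.Primes => 1 - ((p : ℕ) : ℂ) ^ (-s)) (riemannZeta s)⁻¹ := by
    have h := hasProd_inv_of_ne_zero (riemannZeta_eulerProduct_hasProd hs) (riemannZeta_ne_zero_of_one_lt_re hs)
    simpa only [inv_inv] using h
  have hζ' : HasProd (fun p : Nat.Primes => 1 - ((p : ℕ) : ℂ) ^ (-s')) (riemannZeta s')⁻¹ := by
    have h := hasProd_inv_of_ne_zero (riemannZeta_eulerProduct_hasProd hs1)
      (riemannZeta_ne_zero_of_one_lt_re hs1)
    simpa only [inv_inv] using h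
  have hL : HasProd (fun p : Nat.Primes => 1 - χ ((p : ℕ) : ZMod D) * ((p : ℕ) : ℂ) ^ (-s))
      (χ.LFunction s)⁻¹ := by
    have h := hasProd_inv_of_ne_zero (DirichletCharacter.LSeries_eulerProduct_hasProd χ hs)
      (DirichletCharacter.LSeries_ne_zero_of_one_lt_re χ hs)
    rw [DirichletCharacter.LFunction_eq_LSeries χ hs]
    simpa only [inv_inv] using h
  have hL' : HasProd (fun p : Nat.Primes => 1 - χ ((p : ℕ) : ZMod D) * ((p : ℕ) : ℂ) ^ (-s'))
      (χ.LFunction s')⁻¹ := by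
    have h := hasProd_inv_of_ne_zero (DirichletCharacter.LSeries_eulerProduct_hasProd χ hs1)
      (DirichletCharacter.LSeries_ne_zero_of_one_lt_re χ hs1)
    rw [DirichletCharacter.LFunction_eq_LSeries χ hs1]
    simpa only [inv_inv] using h
  have h := (((hζ.mul hζ).mul hζ').mul hL).mul (hL'.mul hL')
  have hval : (normaliserR c' χ j s)⁻¹ = (riemannZeta s)⁻¹ * (riemannZeta s)⁻¹ * (riemannZeta s')⁻¹ *
      (χ.LFunction s)⁻¹ * ((χ.LFunction s')⁻¹ * (χ.LFunction s')⁻¹) := by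
    rw [normaliserR, ← hs']; simp only [mul_inv, pow_two]
  have hfun : (fun q : Nat.Primes =>
        (1 - ((q : ℕ) : ℂ) ^ (-s)) ^ 2 * (1 - ((q : ℕ) : ℂ) ^ betaJ c' D j * ((q : ℕ) : ℂ) ^ (-s)) *
          (1 - χ ((q : ℕ) : ZMod D) * ((q : ℕ) : ℂ) ^ (-s)) *
            (1 - χ ((q : ℕ) : ZMod D) * (((q : ℕ) : ℂ) ^ betaJ c' D j * ((q : ℕ) : ℂ) ^ (-s))) ^ 2) =
      fun p : Nat.Primes => (1 - ((p : ℕ) : ℂ) ^ (-s)) * (1 - ((p : ℕ) : ℂ) ^ (-s)) * (1 - ((p : ℕ) : ℂ) ^ (-s')) *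
        (1 - χ ((p : ℕ) : ZMod D) * ((p : ℕ) : ℂ) ^ (-s)) *
          ((1 - χ ((p : ℕ) : ZMod D) * ((p : ℕ) : ℂ) ^ (-s')) * (1 - χ ((p : ℕ) : ZMod D) * ((p : ℕ) : ℂ) ^ (-s'))) := by
    funext q
    rw [hs', cpow_neg_sub_betaJ c' j q.prop.ne_zero]
    ring
  rw [hval, hfun]
  exact h

end Normaliser

/-! ## §5. `E₂ⱼ(s) = ∏_q Φ_q(s)` on `σ > 1` -/

section Assembly

variable (c' : ℝ) {D : ℕ} [NeZero D] (χ : DirichletCharacter ℂ D) (j : ℕ)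

/-- The repaired series `frakU2SeriesR` is `normaliserR⁻¹` times the `L`-series `Σ_n term(ϖ₂ⱼ(ν∗χ))(s,n)`
(the raw summand vanishes at `n = 0` since `(ν∗χ)(0) = 0`). [cite: Zhang2022LandauSiegel, §16 Lemma 16.2 p.94] -/
theorem frakU2SeriesR_eq (s : ℂ) :
    frakU2SeriesR c' χ j s =
      (normaliserR c' χ j s)⁻¹ * ∑' n : ℕ, LSeries.term (fun n => varpi2 c' χ j n * nuConvChi χ n) s n := by
  unfold frakU2SeriesR
  congr 1
  refine tsum_congr fun n => ?_
  rcases eq_or_ne n 0 with rfl | hn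
  · rw [LSeries.term_zero, nuConvChi_zero, mul_zero, zero_div]
  · rw [LSeries.term_of_ne_zero hn]

/-- **`E₂ⱼ(s) = ∏_q Φ_q(s)` for `σ > 1`** (Lemma 16.2's function at the repaired normaliser, G-d57-1's
`frakU2SeriesR`; under (H1), (H2)): with `x = q^{−s}`, `w = q^{β_j}`, `v = χ(q)`,
`Φ_q(s) = (1−x)²(1−wx)(1−vx)(1−vwx)² · C_q(s)`, `C_2(s) = Σ_e ϖ₂ⱼ(2^e)(ν∗χ)(2^e)x^e`,
`C_q(s) = Σ_e ϖ₂ⱼ^loc(q^e)(ν∗χ)(q^e)x^e` (`q` odd). [cite: Zhang2022LandauSiegel, §16 Lemma 16.2 p.94, App. A p.105] -/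
theorem hasProd_frakU2SeriesR
    (hF : ∀ q : ℕ, q.Prime → q ≠ 2 → 1 / 2 ≤ ‖calM2Factor c' χ q 1 1 (1 - betaJ c' D j)‖)
    {B : ℝ} (hB0 : 0 ≤ B) (hB : ∀ e : ℕ, ‖varpi2 c' χ j (2 ^ e)‖ ≤ B * ((e : ℝ) + 1)) {s : ℂ} (hs : 1 < s.re) :
    HasProd (fun q : Nat.Primes =>
        ((1 - ((q : ℕ) : ℂ) ^ (-s)) ^ 2 * (1 - ((q : ℕ) : ℂ) ^ betaJ c' D j * ((q : ℕ) : ℂ) ^ (-s)) *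
          (1 - χ ((q : ℕ) : ZMod D) * ((q : ℕ) : ℂ) ^ (-s)) *
            (1 - χ ((q : ℕ) : ZMod D) * (((q : ℕ) : ℂ) ^ betaJ c' D j * ((q : ℕ) : ℂ) ^ (-s))) ^ 2) *
        (if (q : ℕ) = 2 then ∑' e : ℕ, varpi2 c' χ j (2 ^ e) * nuConvChi χ (2 ^ e) * ((2 : ℂ) ^ (-s)) ^ e
          else ∑' e : ℕ, varpi2loc c' χ j ((q : ℕ) ^ e) * nuConvChi χ ((q : ℕ) ^ e) * (((q : ℕ) : ℂ) ^ (-s)) ^ e))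
      (frakU2SeriesR c' χ j s) := by
  set T2 : ℂ := ∑' e : ℕ, varpi2 c' χ j (2 ^ e) * nuConvChi χ (2 ^ e) * ((2 : ℂ) ^ (-s)) ^ e with hT2
  have hN := hasProd_normaliserR_inv c' χ j hs
  have hodd := hasProd_oddPart c' χ j hF hs
  -- the single factor at `2`
  have h2 : HasProd (fun q : Nat.Primes => if (q : ℕ) = 2 then T2 else 1) T2 := by
    have h := hasProd_single (f := fun q : Nat.Primes => if (q : ℕ) = 2 then T2 else 1)
      (⟨2, Nat.prime_two⟩ : Nat.Primes) (fun q hq => by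
        rw [if_neg]
        intro h2
        exact hq (Subtype.ext h2))
    simpa using h
  have hall := hN.mul (h2.mul hodd)
  rw [frakU2SeriesR_eq, tsum_varpi2_nuConvChi_eq_twoPart_mul_oddPart c' χ j hF hB0 hB hs, ← hT2]
  have hfun : (fun q : Nat.Primes =>
        ((1 - ((q : ℕ) : ℂ) ^ (-s)) ^ 2 * (1 - ((q : ℕ) : ℂ) ^ betaJ c' D j * ((q : ℕ) : ℂ) ^ (-s)) *
          (1 - χ ((q : ℕ) : ZMod D) * ((q : ℕ) : ℂ) ^ (-s)) *
            (1 - χ ((q : ℕ) : ZMod D) * (((q : ℕ) : ℂ) ^ betaJ c' D j * ((q : ℕ) : ℂ) ^ (-s))) ^ 2) *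
        (if (q : ℕ) = 2 then T2
          else ∑' e : ℕ, varpi2loc c' χ j ((q : ℕ) ^ e) * nuConvChi χ ((q : ℕ) ^ e) * (((q : ℕ) : ℂ) ^ (-s)) ^ e)) =
      fun q : Nat.Primes =>
        ((1 - ((q : ℕ) : ℂ) ^ (-s)) ^ 2 * (1 - ((q : ℕ) : ℂ) ^ betaJ c' D j * ((q : ℕ) : ℂ) ^ (-s)) *
          (1 - χ ((q : ℕ) : ZMod D) * ((q : ℕ) : ℂ) ^ (-s)) *
            (1 - χ ((q : ℕ) : ZMod D) * (((q : ℕ) : ℂ) ^ betaJ c' D j * ((q : ℕ) : ℂ) ^ (-s))) ^ 2) *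
        ((if (q : ℕ) = 2 then T2 else 1) *
          (if (q : ℕ) = 2 then (1 : ℂ) else
            ∑' e : ℕ, varpi2loc c' χ j ((q : ℕ) ^ e) * nuConvChi χ ((q : ℕ) ^ e) * (((q : ℕ) : ℂ) ^ (-s)) ^ e)) := by
    funext q
    split_ifs <;> simp
  rw [hfun]
  exact hall

end Assembly


end Literature.NumberTheory.LFunctions.Zhang2022.Lemma162R

end
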